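import Literature.Probability.Percolation.ConditionalPositiveAssociationProofs
import HarnessLib

/-!
# Quantitative BHK (1/3): the forced-opened cluster `Ĉ` and its block identity

Support file (`--supports stmt-CriticalPhenomena-4575`), prover seat `prim-rate-mine-2` (lane prim-rate, constants-miner (c), rows M2-R8(a)/(b)).
Part 1 of 3 of the proof of the quantitative BHK Thm 1.3 (Glauber floor; see part 3 `…QuantitativeBHKGlauber.lean` for the statement and the
overview): the forced-opened cluster `rCHat U s W e ω` (= `C_s^U(ω ∪ e)` if opening `e` keeps `s ↮ W`, else `C_s^U(ω)`), its monotonicity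
in the avoided set, its reduction to the plain cluster in the degenerate cases, the restriction identity across BHK's block decomposition
(`rCHat_restrict`, the analogue of the tree's `rC_restrict` / identity (6)), and the hatted version of `BHK2006.step_sum`.
Two auxiliary definitions (`rCHat`, `blockEHat`); no named facts, no sorries; standard axioms.
[cite: VandenbergHaggstromKahn2005, Thm. 1.1 (pp. 3–5), identity (6) (p. 4)]
-/

noncomputable section

open MeasureTheory
open Literature.Probability.LatticeModels (prodBernoulli)

namespace Summit.CriticalPhenomena.PercolationContinuityZ3.Theorems

namespace QuantBHK

open Literature.Probability.Percolation Literature.Probability.Percolation.BHK2006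
open scoped Classical
open DecisionTree (ind ind_of_mem ind_of_not_mem ind_nonneg)

section Hat

variable {V : Type*}

/-- The forced-opened cluster: `C_s^U(ω ∪ {e})` if opening `e` keeps `s ↮ W` in `G[U]`, else `C_s^U(ω)`. [cite: VandenbergHaggstromKahn2005, Thm. 1.1 (pp. 3–5), Thm. 1.3 (p. 6)] -/
def rCHat (U : Finset V) (s : V) (W : Set V) (e : Sym2 V) (ω : Set (Sym2 V)) : Set (Sym2 V) :=
  if insert e ω ∈ rD U s W then rC U s (insert e ω) else rC U s ω

/-- Opening a pair enlarges the cluster. [cite: VandenbergHaggstromKahn2005, Thm. 1.1 (pp. 3–5), Thm. 1.3 (p. 6)] -/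
theorem rC_subset_rC_insert (U : Finset V) (s : V) (e : Sym2 V) (ω : Set (Sym2 V)) :
    rC U s ω ⊆ rC U s (insert e ω) := rC_mono U s (Set.subset_insert e ω)

/-- `Ĉ ⊆ C(ω ∪ e)`. [cite: VandenbergHaggstromKahn2005, Thm. 1.1 (pp. 3–5), Thm. 1.3 (p. 6)] -/
theorem rCHat_subset_insert (U : Finset V) (s : V) (W : Set V) (e : Sym2 V) (ω : Set (Sym2 V)) :
    rCHat U s W e ω ⊆ rC U s (insert e ω) := by
  unfold rCHat
  split_ifs
  · exact le_rfl
  · exact rC_subset_rC_insert U s e ω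

/-- `C ⊆ Ĉ`. [cite: VandenbergHaggstromKahn2005, Thm. 1.1 (pp. 3–5), Thm. 1.3 (p. 6)] -/
theorem rC_subset_rCHat (U : Finset V) (s : V) (W : Set V) (e : Sym2 V) (ω : Set (Sym2 V)) :
    rC U s ω ⊆ rCHat U s W e ω := by
  unfold rCHat
  split_ifs
  · exact rC_subset_rC_insert U s e ω
  · exact le_rfl

/-- `Ĉ_W` is antitone in the avoided set `W`. [cite: VandenbergHaggstromKahn2005, Thm. 1.1 (pp. 3–5), Thm. 1.3 (p. 6)] -/
theorem rCHat_antitone {U : Finset V} {s : V} {W W' : Set V} (h : W ⊆ W') (e : Sym2 V) (ω : Set (Sym2 V)) :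
    rCHat U s W' e ω ⊆ rCHat U s W e ω := by
  unfold rCHat
  by_cases h' : insert e ω ∈ rD U s W'
  · rw [if_pos h', if_pos (rD_antitone h h')]
  · rw [if_neg h']
    split_ifs
    · exact rC_subset_rC_insert U s e ω
    · exact le_rfl

/-- With no constraint (`rD U s W = univ`-like hypothesis) the hat is `C(ω ∪ e)`. [cite: VandenbergHaggstromKahn2005, Thm. 1.1 (pp. 3–5), Thm. 1.3 (p. 6)] -/
theorem rCHat_eq_insert_of_mem {U : Finset V} {s : V} {W : Set V} {e : Sym2 V} {ω : Set (Sym2 V)}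
    (h : insert e ω ∈ rD U s W) : rCHat U s W e ω = rC U s (insert e ω) := by
  unfold rCHat; rw [if_pos h]

/-- If opening `e` is not admissible the hat is the cluster. [cite: VandenbergHaggstromKahn2005, Thm. 1.1 (pp. 3–5), Thm. 1.3 (p. 6)] -/
theorem rCHat_eq_of_not_mem {U : Finset V} {s : V} {W : Set V} {e : Sym2 V} {ω : Set (Sym2 V)}
    (h : insert e ω ∉ rD U s W) : rCHat U s W e ω = rC U s ω := by
  unfold rCHat; rw [if_neg h]

/-- Inserting a pair avoiding `Z` does not change `S`. [cite: VandenbergHaggstromKahn2005, Thm. 1.1 (pp. 3–5), Thm. 1.3 (p. 6)] -/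
theorem rS_insert_of_not_meeting {U Z : Finset V} {e : Sym2 V} (he : e ∉ meeting Z) (ω : Set (Sym2 V)) :
    rS U Z (insert e ω) = rS U Z ω := by
  ext n
  constructor
  · rintro ⟨hn, z, hz, h⟩
    rcases Set.mem_insert_iff.1 h with h1 | h1
    · exact absurd ⟨z, hz, h1 ▸ Sym2.mem_mk_right n z⟩ he
    · exact ⟨hn, z, hz, h1⟩
  · rintro ⟨hn, z, hz, h⟩
    exact ⟨hn, z, hz, Set.mem_insert_of_mem _ h⟩

/-- Inserting an element outside `A` commutes with removing `A`. [folklore] -/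
theorem insert_diff_of_not_mem {α : Type*} {e : α} {ω A : Set α} (he : e ∉ A) :
    insert e ω \ A = insert e (ω \ A) := by
  ext x
  simp only [Set.mem_sdiff, Set.mem_insert_iff]
  constructor
  · rintro ⟨h | h, hx⟩
    · exact Or.inl h
    · exact Or.inr ⟨h, hx⟩
  · rintro (h | ⟨h, hx⟩)
    · exact ⟨Or.inl h, h ▸ he⟩
    · exact ⟨Or.inr h, hx⟩

/-- **Restriction of the hat (the ★ block identity of PROOFS §P12).**  For `Z ⊆ U`, `s ∉ Z`, `Z ⊆ W`, a pair `e` not meeting `Z`,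
and `ω ∈ R_W`: `Ĉ^U_W(ω) = Ĉ^{U∖Z}_{(W∖Z) ∪ S(ω)}(ω ∖ meeting Z)`. [cite: VandenbergHaggstromKahn2005, Thm. 1.1 (pp. 3–5), Thm. 1.3 (p. 6)] -/
theorem rCHat_restrict {U Z : Finset V} (hZU : Z ⊆ U) {s : V} (hs : s ∉ Z) {W : Set V} (hZW : (↑Z : Set V) ⊆ W)
    {e : Sym2 V} (he : e ∉ meeting Z) {ω : Set (Sym2 V)} (hω : ω ∈ rD U s W) :
    rCHat U s W e ω = rCHat (U \ Z) s ((W \ ↑Z) ∪ rS U Z ω) e (ω \ meeting Z) := by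
  have hSins : rS U Z (insert e ω) = rS U Z ω := rS_insert_of_not_meeting he ω
  have hdiff : insert e ω \ meeting Z = insert e (ω \ meeting Z) := insert_diff_of_not_mem he
  -- admissibility transfers
  have hadm : insert e ω ∈ rD U s W ↔ insert e (ω \ meeting Z) ∈ rD (U \ Z) s ((W \ ↑Z) ∪ rS U Z ω) := by
    rw [mem_rD_iff_restrict hZU hs hZW (insert e ω), hSins, ← hdiff, mem_rD_diff_meeting]
  -- the clusters transfer
  have hS0 : ∀ n ∈ rS U Z ω, ¬ (openGraph (ω ∩ edgesIn (U \ Z))).Reachable s n := by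
    have h := (mem_rD_iff_restrict hZU hs hZW ω).1 hω
    exact fun n hn => h n (Or.inr hn)
  unfold rCHat
  by_cases h1 : insert e ω ∈ rD U s W
  · rw [if_pos h1, if_pos (hadm.1 h1)]
    have hS1 : ∀ n ∈ rS U Z (insert e ω), ¬ (openGraph ((insert e ω) ∩ edgesIn (U \ Z))).Reachable s n := by
      have h := (mem_rD_iff_restrict hZU hs hZW (insert e ω)).1 h1
      exact fun n hn => h n (Or.inr hn)
    rw [rC_restrict hs hS1, ← hdiff, rC_diff_meeting]
  · rw [if_neg h1, if_neg (fun h => h1 (hadm.2 h)), rC_restrict hs hS0, rC_diff_meeting]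

/-- If an endpoint of `e` lies in `Z ⊆ W` and `ω ∪ e ∈ R_W`, opening `e` does not change the cluster. [cite: VandenbergHaggstromKahn2005, Thm. 1.1 (pp. 3–5), Thm. 1.3 (p. 6)] -/
theorem rC_insert_eq_of_meeting {U Z : Finset V} {s : V} {W : Set V} (hZW : (↑Z : Set V) ⊆ W)
    {e : Sym2 V} (he : e ∈ meeting Z) {ω : Set (Sym2 V)} (hω : insert e ω ∈ rD U s W) :
    rC U s (insert e ω) = rC U s ω := by
  obtain ⟨z, hz, hze⟩ := he
  have hz' : ¬ (openGraph (insert e ω ∩ edgesIn U)).Reachable s z := hω z (hZW hz)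
  -- every walk from `s` in the larger graph avoids `e`
  have key : ∀ v, (openGraph (insert e ω ∩ edgesIn U)).Reachable s v → (openGraph (ω ∩ edgesIn U)).Reachable s v := by
    intro v hv
    obtain ⟨p⟩ := hv
    refine ⟨p.transfer (openGraph (ω ∩ edgesIn U)) fun f hf => ?_⟩
    have hf' := p.edges_subset_edgeSet hf
    rw [openGraph, SimpleGraph.edgeSet_fromEdgeSet] at hf' ⊢
    refine ⟨⟨?_, hf'.1.2⟩, hf'.2⟩
    rcases Set.mem_insert_iff.1 hf'.1.1 with h | h
    · exact absurd (p.takeUntil z (SimpleGraph.Walk.mem_support_of_mem_edges hf (h ▸ hze))).reachable hz'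
    · exact h
  refine Set.Subset.antisymm ?_ (rC_subset_rC_insert U s e ω)
  intro f hf
  simp only [rC, mem_openEdgeCluster_iff, Set.mem_inter_iff] at hf ⊢
  obtain ⟨⟨hfω, hfU⟩, hd, hr⟩ := hf
  refine ⟨⟨?_, hfU⟩, hd, fun v hv => key v (hr v hv)⟩
  rcases Set.mem_insert_iff.1 hfω with h | h
  · subst h
    exact absurd (key z (hr z hze)) (fun h => hz' ((h.mono (openGraph_le (Set.inter_subset_inter_left _ (Set.subset_insert f ω))))))
  · exact h

/-- If `e` is not a pair of `G[U]`, opening it changes nothing inside `U`. [cite: VandenbergHaggstromKahn2005, Thm. 1.1 (pp. 3–5), Thm. 1.3 (p. 6)] -/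
theorem rC_insert_eq_of_not_edgesIn {U : Finset V} (s : V) {e : Sym2 V} (he : e ∉ edgesIn U) (ω : Set (Sym2 V)) :
    rC U s (insert e ω) = rC U s ω := by
  have : insert e ω ∩ edgesIn U = ω ∩ edgesIn U := by
    ext f; simp only [Set.mem_inter_iff, Set.mem_insert_iff]
    constructor
    · rintro ⟨h | h, hU⟩
      · exact absurd (h ▸ hU) he
      · exact ⟨h, hU⟩
    · rintro ⟨h, hU⟩; exact ⟨Or.inr h, hU⟩
  simp only [rC, this]

/-- A pair outside `G[U]` is invisible to the events `R_W` of `G[U]`. [folklore] -/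
theorem rD_insert_iff_of_not_edgesIn {U : Finset V} (s : V) (W : Set V) {e : Sym2 V} (he : e ∉ edgesIn U) (ω : Set (Sym2 V)) :
    insert e ω ∈ rD U s W ↔ ω ∈ rD U s W := by
  have : insert e ω ∩ edgesIn U = ω ∩ edgesIn U := by
    ext f; simp only [Set.mem_inter_iff, Set.mem_insert_iff]
    constructor
    · rintro ⟨h | h, hU⟩
      · exact absurd (h ▸ hU) he
      · exact ⟨h, hU⟩
    · rintro ⟨h, hU⟩; exact ⟨Or.inr h, hU⟩
  simp only [rD, Set.mem_setOf_eq, this]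

/-- In the «degenerate» cases (e meets `Z ⊆ W`, or e is not a pair of `G[U]`) the hat is the cluster on `R_W`. [cite: VandenbergHaggstromKahn2005, Thm. 1.1 (pp. 3–5), Thm. 1.3 (p. 6)] -/
theorem rCHat_eq_rC_of_degenerate {U Z : Finset V} {s : V} {W : Set V} (hZW : (↑Z : Set V) ⊆ W) {e : Sym2 V}
    (he : e ∈ meeting Z ∨ e ∉ edgesIn U) (ω : Set (Sym2 V)) :
    rCHat U s W e ω = rC U s ω := by
  unfold rCHat
  by_cases h1 : insert e ω ∈ rD U s W
  · rw [if_pos h1]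
    rcases he with he | he
    · exact rC_insert_eq_of_meeting hZW he h1
    · exact rC_insert_eq_of_not_edgesIn s he ω
  · rw [if_neg h1]

variable [Fintype V]

/-- The block expectation with the hat in the second slot:
`T ↦ E[F(C^{U'}) · G(Ĉ^{U'}_{B ∪ T}) · 1{s ↮ B ∪ T in G[U']}]`. [cite: VandenbergHaggstromKahn2005, Thm. 1.1 (pp. 3–5), Thm. 1.3 (p. 6)] -/
def blockEHat (w : Sym2 V → ℝ) (U' : Finset V) (s : V) (F G : Set (Sym2 V) → ℝ) (e : Sym2 V) (B T : Set V) : ℝ :=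
  ∑ ω, weight w ω * (F (rC U' s ω) * G (rCHat U' s (B ∪ T) e ω) * ind (rD U' s (B ∪ T)) ω)

/-- Hatted block expectations of nonnegative functions are nonnegative. [folklore] -/
theorem blockEHat_nonneg {w : Sym2 V → ℝ} (hw0 : ∀ e, 0 ≤ w e) (hw1 : ∀ e, w e ≤ 1)
    (U' : Finset V) (s : V) {F G : Set (Sym2 V) → ℝ} (hF : ∀ a, 0 ≤ F a) (hG : ∀ a, 0 ≤ G a) (e : Sym2 V) (B T : Set V) :
    0 ≤ blockEHat w U' s F G e B T :=
  Finset.sum_nonneg fun ω _ => mul_nonneg (weight_nonneg hw0 hw1 ω)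
    (mul_nonneg (mul_nonneg (hF _) (hG _)) (ind_nonneg _ _))

/-- The hatted block expectation is antitone in `T` (★ antitonicity of PROOFS §P12). [cite: VandenbergHaggstromKahn2005, Thm. 1.1 (pp. 3–5), Thm. 1.3 (p. 6)] -/
theorem blockEHat_antitone {w : Sym2 V → ℝ} (hw0 : ∀ e, 0 ≤ w e) (hw1 : ∀ e, w e ≤ 1)
    (U' : Finset V) (s : V) {F G : Set (Sym2 V) → ℝ} (hF : ∀ a, 0 ≤ F a) (hG : ∀ a, 0 ≤ G a) (hGm : Monotone G)
    (e : Sym2 V) (B : Set V) {T T' : Set V} (h : T ⊆ T') :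
    blockEHat w U' s F G e B T' ≤ blockEHat w U' s F G e B T := by
  refine Finset.sum_le_sum fun ω _ => mul_le_mul_of_nonneg_left ?_ (weight_nonneg hw0 hw1 ω)
  have hsub : B ∪ T ⊆ B ∪ T' := Set.union_subset_union_right B h
  refine mul_le_mul (mul_le_mul_of_nonneg_left (hGm (rCHat_antitone hsub e ω)) (hF _))
    (ind_mono (rD_antitone hsub) ω) (ind_nonneg _ _) (mul_nonneg (hF _) (hG _))

/-- **`step_sum` with the hat**: for `Z ⊆ W` and `e` not meeting `Z`,
`E[F(C) G(Ĉ_W) 1{s↮W}] = Σ_ω weight(ω) · blockEHat(U∖Z; F, G; W∖Z; S(ω))`. [cite: VandenbergHaggstromKahn2005, Thm. 1.1 (pp. 3–5), Thm. 1.3 (p. 6)] -/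
theorem step_sum_hat {U Z : Finset V} (hZU : Z ⊆ U) {s : V} (hs : s ∉ Z) {W : Set V}
    (hZW : (↑Z : Set V) ⊆ W) (w : Sym2 V → ℝ) (hm : ∑ ω, weight w ω = 1)
    (F G : Set (Sym2 V) → ℝ) {e : Sym2 V} (he : e ∉ meeting Z) :
    ∑ ω, weight w ω * (F (rC U s ω) * G (rCHat U s W e ω) * ind (rD U s W) ω) =
      ∑ ω, weight w ω * blockEHat w (U \ Z) s F G e (W \ ↑Z) (rS U Z ω) := by
  set A := meeting Z with hA
  set Φ : Set (Sym2 V) → Set (Sym2 V) → ℝ := fun ζ η =>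
    F (rC (U \ Z) s η) * G (rCHat (U \ Z) s ((W \ ↑Z) ∪ rS U Z ζ) e η) *
      ind (rD (U \ Z) s ((W \ ↑Z) ∪ rS U Z ζ)) η with hΦ
  have h1 : ∀ ω, F (rC U s ω) * G (rCHat U s W e ω) * ind (rD U s W) ω = Φ (ω ∩ A) (ω \ A) := by
    intro ω
    simp only [hΦ, hA, rS_inter_meeting, rC_diff_meeting]
    by_cases hω : ω ∈ rD U s W
    · have hω' := (mem_rD_iff_restrict hZU hs hZW ω).1 hω
      rw [ind_of_mem hω, ind_of_mem ((mem_rD_diff_meeting U Z s _ ω).2 hω'),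
        rC_restrict hs fun n hn => hω' n (Or.inr hn), ← rCHat_restrict hZU hs hZW he hω]
    · have hω' : ω \ meeting Z ∉ rD (U \ Z) s ((W \ ↑Z) ∪ rS U Z ω) := fun h =>
        hω ((mem_rD_iff_restrict hZU hs hZW ω).2 ((mem_rD_diff_meeting U Z s _ ω).1 h))
      rw [ind_of_not_mem hω, ind_of_not_mem hω', mul_zero, mul_zero]
  have h2 : ∀ ω ω', Φ (ω ∩ A) (ω' \ A) =
      F (rC (U \ Z) s ω') * G (rCHat (U \ Z) s ((W \ ↑Z) ∪ rS U Z ω) e (ω' \ A)) *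
        ind (rD (U \ Z) s ((W \ ↑Z) ∪ rS U Z ω)) ω' := by
    intro ω ω'
    simp only [hΦ, hA, rS_inter_meeting, rC_diff_meeting]
    by_cases hω' : ω' ∈ rD (U \ Z) s ((W \ ↑Z) ∪ rS U Z ω)
    · rw [ind_of_mem hω', ind_of_mem ((mem_rD_diff_meeting U Z s _ ω').2 hω')]
    · rw [ind_of_not_mem hω', ind_of_not_mem (fun h => hω' ((mem_rD_diff_meeting U Z s _ ω').1 h)),
        mul_zero]
  -- the hat inside `U ∖ Z` does not see the pairs meeting `Z` either
  have h3 : ∀ ω ω', rCHat (U \ Z) s ((W \ ↑Z) ∪ rS U Z ω) e (ω' \ A) = rCHat (U \ Z) s ((W \ ↑Z) ∪ rS U Z ω) e ω' := by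
    intro ω ω'
    unfold rCHat
    rw [hA, ← insert_diff_of_not_mem he, mem_rD_diff_meeting, rC_diff_meeting, rC_diff_meeting]
  calc ∑ ω, weight w ω * (F (rC U s ω) * G (rCHat U s W e ω) * ind (rD U s W) ω)
      = (∑ ω, weight w ω) * ∑ ω, weight w ω * Φ (ω ∩ A) (ω \ A) := by
        rw [hm, one_mul]; exact Finset.sum_congr rfl fun ω _ => by rw [h1 ω]
    _ = ∑ ω, weight w ω * ∑ ω', weight w ω' * Φ (ω ∩ A) (ω' \ A) := blockFubini w A Φ
    _ = ∑ ω, weight w ω * blockEHat w (U \ Z) s F G e (W \ ↑Z) (rS U Z ω) := by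
        refine Finset.sum_congr rfl fun ω _ => ?_
        congr 1
        unfold blockEHat
        refine Finset.sum_congr rfl fun ω' _ => ?_
        rw [h2, h3]

end Hat

end QuantBHK

end Summit.CriticalPhenomena.PercolationContinuityZ3.Theorems
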